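/-
Copyright: statement-level skeleton of a published paper (lit-balaban cell, Phase-2 proof seat p25, gen 18). No proof
claims beyond what the kernel checks below.
-/
import Literature.MathematicalPhysics.QuantumFieldTheory.BalabanImbrieJaffe1984to88.BIJ88WalkTermCount312
import Literature.MathematicalPhysics.QuantumFieldTheory.BalabanImbrieJaffe1984to88.BIJ88WalkLocalCount312
import Literature.MathematicalPhysics.QuantumFieldTheory.BalabanImbrieJaffe1984to88.BIJ88WalkExpansionGeo311
import Literature.MathematicalPhysics.QuantumFieldTheory.BalabanImbrieJaffe1984to88.BIJ88WalkActivityShape312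

/-!
# `BalabanImbrieJaffe1984to88.BIJ88WalkLocalTermCount312` — T. Bałaban, J. Imbrie, A. Jaffe, *Effective action and
cluster properties of the abelian Higgs model*, Commun. Math. Phys. **114** (1988) 257–315 [BalabanImbrieJaffe1988],
§5.14 p. 311–312 [PDF 55–56], verbatim: *"After sufficiently many integrations by parts, all components of X will be
complete"*, p. 310 [PDF 54] verbatim: *"It is now a standard exercise to estimate the expansion, using (5.14.4)."*,
p. 312 verbatim: *"By performing sufficiently many integrations by parts, we have arranged for enough small factors
to beat these large factors in the remainder terms (at least if X_{r′} is not at the boundary of Λ^{(k)})."* (DOCFIX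
p25 gen 19, ref-5 D-g64-2: the gen-18 header paraphrased the last sentence inside quotation marks; the printed
sentences are restored with their pages, declarations untouched) — **THE LOCAL COUNT OF THE NONDEGENERATE TERMS OF
THE WHOLE
EXPANSION, AND THE ℓ¹ NORM OF THE EXPANSION MEASURED IN THE PRINTED CURRENCY** (p25 gen 18): the local count along a
run (`BIJ88WalkLocalCount312.run_lsum_le`: pieces summed over those seeing the current leg, vertices over those
coupled to it) telescopes along the expansion exactly as the global one (`BIJ88WalkTermCount312.expand_wsum_le`):
`Σ_{t nondegenerate} Π_{X ∈ blocks ∪ remainder components} Π_{p ∈ X.pcs} ρ p ≤ W^{Φ(done,rest)}·Π_{h∈done} Π_{p∈h.pcs} ρ p`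
for `ρ₀·(Φ + N₀) ≤ W` (`expand_lsum_le`); hence, splitting the bracket bounds `B = B′·ρ` into an activity part and a
counting part, THE SIZES OF ALL THE TERMS MEASURED IN UNITS OF THEIR PRINTED SHAPE SUM TO AT MOST `W^{Φ₀(K)}`:
`Σ_{t ∈ expand 0 K} |coef_t|·Π‖dirs_t‖ / Π_{X} shape X ≤ W^{Φ₀(K)}`, `shape X = (Π_{j∈X.lab} B_ℓ^{|obs j|})·θ^{#(cubes X ∖ obs cubes)}`
(`expand_l1_shape_le`) — uniformly in the number of pieces and of vertices.

statement-level skeleton of published theorems with citation tags; proofs where landed; nothing here is a claim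
about the Yang–Mills mass gap

PDF held: `paper:balaban1988-cmp114-bij-abelian-higgs-effective-action` (journal page = PDF page + 256); p. 311–312 =
PDF 55–56 (`p0055.txt` L23–38, `p0056.txt` L1–25 re-read 2026-08-22; `p0054.txt` L25 and `p0056.txt` L20–25 re-read for
the docfix, 2026-08-23).

CITATION HEADER (lean-in-tree rule).  lit-balaban cell (HOME `run/shared/lean/pub/lit-balaban/`), Phase 2, seat p25
gen 18; row **C2.Claim@312** of `HOME/lit-balaban-r16/ROWS-C2-part2.md` (owner r16, referee ref-5; head
`BIJ88Sect5StatementsPart4.Ineq312` untouched — MEMBER of the row).  USED BY NAME, nothing restated: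
`BIJ88WalkTermCount312.{pot, pw, rpot_pristine_le_pot, expand_pot_key, pw_outcome}`,
`BIJ88WalkLocalCount312.{nds, run_lsum_le}`, `BIJ88WalkExpansionGeo311.{NondegT, nondeg_of_oact}`,
`BIJ88WalkActivityShape312.{shape, wt_le_shape, expand_tidy, envOK_zero}`, `BIJ88WalkWeights312.{wt, run_pend_dir,
expand_weight_init}`, `BIJ88WalkRun311`, `BIJ88WalkRunEnv311.{run_rest_subset, run_done_le}`, `BIJ88WalkExpansion311`
(this seat and generation), `BIJ88LabelledRun311.mbind`, `BIJ88VertexComponents311.maxArity`.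

## What is proved (0 `sorry`, standard axioms, no new `Prop` facts; theorems only)

* §1 **`expand_lsum_le`** (the local count along the expansion), `expand_lsum_init_le`.
* §2 **`expand_l1_shape_le`** (the ℓ¹ norm of the expansion of a product of observables in units of the printed shape).
HONEST SCOPE: (a) locality (`ρ₀`, `N₀`) and the split `B = B′·ρ` are HYPOTHESES in abstract form; (b) the remainder
components enter through `|coef|·Π‖dirs‖` only — the Gaussian integral of their pending structure
(`BIJ88WalkIdentity311.tval`) is not estimated; (c) the constant is `W^{Φ₀(K)}`; (d) contraction-graph components;
(e) no `Ineq312` binder.  NOT summit progress; NOT continuum; NOT Clay.  Imports `BIJ88WalkTermCount312`,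
`BIJ88WalkLocalCount312`, `BIJ88WalkExpansionGeo311`, `BIJ88WalkActivityShape312`; modifies nothing.
-/

noncomputable section

namespace Literature.MathematicalPhysics.QuantumFieldTheory.BalabanImbrieJaffe1984to88.BIJ88WalkLocalTermCount312

open Classical Matrix Finset
open scoped BigOperators
open BIJ88VertexComponents311 (maxArity)
open BIJ88LabelledRun311 (mbind)
open BIJ88WalkRun311 BIJ88WalkRunEnv311 BIJ88WalkGeometry311 BIJ88WalkExpansion311 BIJ88WalkExpansionGeo311
  BIJ88WalkWeights312 BIJ88WalkActivityShape312 BIJ88WalkTermCount312 BIJ88WalkLocalCount312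

variable {S : Type} [Fintype S] {ι : Type} [Fintype ι] {κ : Type} [LinearOrder κ] {P : Type} [Fintype P]

/-! ## §1  The local count along the expansion -/

section Expand

variable {Cov : P → Matrix S S ℝ} {trig : P → Bool} {f : S → ℝ} {c : ι → ℝ} {legs : ι → List (S → ℝ)}
  {obs : κ → List (S → ℝ)} {M : ℕ} {ρ : P → ℝ} {Dir : Set (S → ℝ)} {ρ₀ : ℝ} {N₀ : ℕ}

omit [Fintype S] [Fintype ι] [LinearOrder κ] [Fintype P] in
/-- Piece weights are nonnegative for `ρ ≥ 0` (bookkeeping). [folklore] -/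
private theorem pw_nonneg' (hρ : ∀ p, 0 ≤ ρ p) (g : WGrp S κ ι P) : 0 ≤ pw ρ g :=
  Multiset.prod_nonneg fun x hx => by obtain ⟨p, -, rfl⟩ := Multiset.mem_map.1 hx; exact hρ p

omit [Fintype S] [Fintype ι] [LinearOrder κ] [Fintype P] in
/-- Products of piece weights are nonnegative (bookkeeping). [folklore] -/
private theorem prod_pw_nonneg' (hρ : ∀ p, 0 ≤ ρ p) (m : Multiset (WGrp S κ ι P)) : 0 ≤ (m.map (pw ρ)).prod :=
  Multiset.prod_nonneg fun x hx => by obtain ⟨g, -, rfl⟩ := Multiset.mem_map.1 hx; exact pw_nonneg' hρ g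

omit [Fintype S] [Fintype ι] [LinearOrder κ] [Fintype P] in
/-- Booking a block does not change nondegeneracy (bookkeeping). [folklore] -/
private theorem nondegT_addConst (g : WGrp S κ ι P) (t : WTerm S κ ι P) : NondegT (t.addConst g) ↔ NondegT t := by
  simp only [NondegT, WTerm.addConst_coef, WTerm.addConst_dirs]

/-- **THE LOCAL WEIGHTED COUNT ALONG THE EXPANSION**: observables and vertex legs with directions in `Dir`, the
pending legs of the components set aside in `Dir`; `ρ ≥ 0` with `Σ_{p : C_p u ≠ 0} ρ p ≤ ρ₀` (`u ∈ Dir`, `ρ₀ ≥ 0`); at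
most `N₀` (vertex, leg) pairs coupled to one `C_p u`; `W ≥ 1`, `ρ₀·(Φ(done,rest) + N₀) ≤ W`.  Then
`Σ_{t ∈ expand done rest, t nondegenerate} Π_{X ∈ t.consts + t.groups} pw X ≤ W^{Φ(done,rest)} · Π_{h ∈ done} pw h`.
[cite: BalabanImbrieJaffe1988, §5.14 p.311–312] -/
theorem expand_lsum_le (hobs : ∀ j, ∀ w ∈ obs j, w ∈ Dir) (hlegs : ∀ m, ∀ w ∈ legs m, w ∈ Dir) (hρ : ∀ p, 0 ≤ ρ p)
    (hρ₀0 : 0 ≤ ρ₀) (hρ₀ : ∀ u ∈ Dir, (∑ p ∈ univ.filter (fun p => Cov p *ᵥ u ≠ 0), ρ p) ≤ ρ₀)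
    (hN : ∀ p, ∀ u ∈ Dir,
      (∑ m, ((range (legs m).length).filter fun j => (Cov p *ᵥ u) ⬝ᵥ (legs m).getD j 0 ≠ 0).card) ≤ N₀) :
    ∀ (n : ℕ) (done : Multiset (WGrp S κ ι P)) (rest : Finset κ), rest.card < n →
      (∀ h ∈ done, ∀ w ∈ h.pend, w ∈ Dir) → ∀ W : ℝ, 1 ≤ W →
        ρ₀ * ((pot obs M (maxArity legs) done rest + N₀ : ℕ) : ℝ) ≤ W →
          ((expand Cov trig f c legs obs M done rest).map fun t =>
              if NondegT t then ((t.consts + t.groups).map (pw ρ)).prod else 0).sum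
            ≤ W ^ pot obs M (maxArity legs) done rest * (done.map (pw ρ)).prod
  | 0, _, _, hn => fun _ _ _ _ => absurd hn (Nat.not_lt_zero _)
  | n + 1, done, rest, hn => by
    intro hd W hW1 hW
    have hW0 : 0 ≤ W := zero_le_one.trans hW1
    by_cases h : rest.Nonempty
    · have hi := rest.min'_mem h
      have hRs := rpot_pristine_le_pot (P := P) (legs := legs) (obs := obs) (M := M) h done
      obtain ⟨Φ, hΦ⟩ : ∃ Φ, Φ = pot obs M (maxArity legs) done rest := ⟨_, rfl⟩
      obtain ⟨R0, hR0⟩ : ∃ R0, R0 = rpot obs M (maxArity legs) (pristine (P := P) obs (rest.min' h))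
        (rest.erase (rest.min' h)) done := ⟨_, rfl⟩
      rw [← hΦ] at hW hRs ⊢
      rw [← hR0] at hRs
      rw [expand_of_nonempty Cov trig f c legs obs M h, mbind, Multiset.map_bind, Multiset.sum_bind]
      have hpr : ∀ w ∈ (pristine (ι := ι) (P := P) obs (rest.min' h)).pend, w ∈ Dir := fun w hw => hobs _ w hw
      -- every outcome's continuation
      have hcont : ∀ o ∈ run Cov trig f c legs obs M (pristine obs (rest.min' h)) (rest.erase (rest.min' h)) done,
          ((if o.g.IsConst M then (expand Cov trig f c legs obs M o.done o.rest).map fun t => (oact o t).addConst o.g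
            else (expand Cov trig f c legs obs M (o.g ::ₘ o.done) o.rest).map (oact o)).map
              fun t => if NondegT t then ((t.consts + t.groups).map (pw ρ)).prod else 0).sum
          ≤ W ^ (Φ - R0) * (nds obs M legs ρ W o * (done.map (pw ρ)).prod) := by
        intro o ho
        have hcard : o.rest.card < n := lt_of_lt_of_le (lt_of_le_of_lt (Finset.card_le_card (run_rest_subset _ _ _ o ho))
          (Finset.card_erase_lt_of_mem hi)) (Nat.lt_succ_iff.1 hn)
        have hpw := pw_outcome (Cov := Cov) (trig := trig) (f := f) (c := c) (M := M) ρ (rest.min' h)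
          (rest.erase (rest.min' h)) done o ho
        have hle := run_rpot_le (Cov := Cov) (trig := trig) (f := f) (c := c) (legs := legs) (obs := obs) (M := M)
          _ _ _ o ho
        rw [← hR0] at hle
        have hdo : ∀ h' ∈ o.done, ∀ w ∈ h'.pend, w ∈ Dir := fun h' hh' =>
          hd h' (Multiset.mem_of_le (run_done_le _ _ _ o ho) hh')
        have hgo : ∀ w ∈ o.g.pend, w ∈ Dir := run_pend_dir hobs hlegs _ _ _ o ho hpr hd
        by_cases hnd : Nondeg o
        swap
        · -- a degenerate outcome: every continuation term is degenerate
          rw [nds, if_neg hnd, zero_mul, mul_zero]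
          refine le_of_eq (Multiset.sum_eq_zero fun x hx => ?_)
          obtain ⟨t', ht', rfl⟩ := Multiset.mem_map.1 hx
          rw [if_neg]
          intro hT
          split_ifs at ht' with hg
          · obtain ⟨t, -, rfl⟩ := Multiset.mem_map.1 ht'
            exact hnd (nondeg_of_oact ((nondegT_addConst _ _).1 hT)).1
          · obtain ⟨t, -, rfl⟩ := Multiset.mem_map.1 ht'
            exact hnd (nondeg_of_oact hT).1
        rw [nds, if_pos hnd]
        split_ifs with hg
        · have key := expand_pot_key (P := P) h done o ho 0 (Nat.zero_le _)
          rw [← hR0, ← hΦ] at key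
          rw [Multiset.map_map]
          have hb : ρ₀ * ((pot obs M (maxArity legs) o.done o.rest + N₀ : ℕ) : ℝ) ≤ W :=
            le_trans (mul_le_mul_of_nonneg_left (by exact_mod_cast (by omega :
              pot obs M (maxArity legs) o.done o.rest + N₀ ≤ Φ + N₀)) hρ₀0) hW
          have IH := expand_lsum_le hobs hlegs hρ hρ₀0 hρ₀ hN n o.done o.rest hcard hdo W hW1 hb
          have hpt : ∀ t ∈ expand Cov trig f c legs obs M o.done o.rest,
              ((fun t : WTerm S κ ι P => if NondegT t then ((t.consts + t.groups).map (pw ρ)).prod else 0)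
                ∘ fun t => (oact o t).addConst o.g) t
                ≤ pw ρ o.g * (if NondegT t then ((t.consts + t.groups).map (pw ρ)).prod else 0) := by
            intro t _
            simp only [Function.comp_apply]
            by_cases hT : NondegT ((oact o t).addConst o.g)
            · have hT' : NondegT t := (nondeg_of_oact ((nondegT_addConst _ _).1 hT)).2
              rw [if_pos hT, if_pos hT']
              simp only [WTerm.addConst_consts, WTerm.addConst_groups, oact_consts, oact_groups, Multiset.cons_add,
                Multiset.map_cons, Multiset.prod_cons]
              exact le_rfl
            · rw [if_neg hT]
              refine mul_nonneg (pw_nonneg' hρ _) ?_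
              split_ifs
              · exact prod_pw_nonneg' hρ _
              · exact le_rfl
          calc _ ≤ ((expand Cov trig f c legs obs M o.done o.rest).map fun t =>
                  pw ρ o.g * (if NondegT t then ((t.consts + t.groups).map (pw ρ)).prod else 0)).sum :=
                Multiset.sum_map_le_sum_map _ _ hpt
            _ = pw ρ o.g * ((expand Cov trig f c legs obs M o.done o.rest).map fun t =>
                  if NondegT t then ((t.consts + t.groups).map (pw ρ)).prod else 0).sum := by
                rw [Multiset.sum_map_mul_left]
            _ ≤ pw ρ o.g * (W ^ pot obs M (maxArity legs) o.done o.rest * (o.done.map (pw ρ)).prod) :=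
                mul_le_mul_of_nonneg_left IH (pw_nonneg' hρ _)
            _ = W ^ pot obs M (maxArity legs) o.done o.rest * (pw ρ o.g * (o.done.map (pw ρ)).prod) := by ring
            _ = W ^ pot obs M (maxArity legs) o.done o.rest * ((o.dp.map ρ).prod * (done.map (pw ρ)).prod) := by
                rw [hpw]
            _ ≤ W ^ (Φ - R0 + rpot obs M (maxArity legs) o.g o.rest o.done)
                  * ((o.dp.map ρ).prod * (done.map (pw ρ)).prod) :=
                mul_le_mul_of_nonneg_right (pow_le_pow_right₀ hW1 (by omega))
                  (mul_nonneg (Multiset.prod_nonneg fun x hx => by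
                    obtain ⟨p, -, rfl⟩ := Multiset.mem_map.1 hx; exact hρ p) (prod_pw_nonneg' hρ _))
            _ = _ := by rw [pow_add]; ring
        · have key := expand_pot_key (P := P) h done o ho o.g.pend.length le_rfl
          rw [← hR0, ← hΦ] at key
          rw [Multiset.map_map]
          have hpot : pot obs M (maxArity legs) (o.g ::ₘ o.done) o.rest
              = o.g.pend.length + pot obs M (maxArity legs) o.done o.rest := by
            simp only [pot, Multiset.map_cons, Multiset.sum_cons, add_assoc]
          have hb : ρ₀ * ((pot obs M (maxArity legs) (o.g ::ₘ o.done) o.rest + N₀ : ℕ) : ℝ) ≤ W :=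
            le_trans (mul_le_mul_of_nonneg_left (by exact_mod_cast (by omega :
              pot obs M (maxArity legs) (o.g ::ₘ o.done) o.rest + N₀ ≤ Φ + N₀)) hρ₀0) hW
          have hd' : ∀ h' ∈ o.g ::ₘ o.done, ∀ w ∈ h'.pend, w ∈ Dir := fun h' hh' => by
            rcases Multiset.mem_cons.1 hh' with rfl | hh'
            · exact hgo
            · exact hdo h' hh'
          have IH := expand_lsum_le hobs hlegs hρ hρ₀0 hρ₀ hN n (o.g ::ₘ o.done) o.rest hcard hd' W hW1 hb
          have hpt : ∀ t ∈ expand Cov trig f c legs obs M (o.g ::ₘ o.done) o.rest,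
              ((fun t : WTerm S κ ι P => if NondegT t then ((t.consts + t.groups).map (pw ρ)).prod else 0) ∘ oact o) t
                ≤ (if NondegT t then ((t.consts + t.groups).map (pw ρ)).prod else 0) := by
            intro t _
            simp only [Function.comp_apply]
            by_cases hT : NondegT (oact o t)
            · rw [if_pos hT, if_pos (nondeg_of_oact hT).2]
              simp only [oact_consts, oact_groups]
              exact le_rfl
            · rw [if_neg hT]
              split_ifs
              · exact prod_pw_nonneg' hρ _
              · exact le_rfl
          calc _ ≤ ((expand Cov trig f c legs obs M (o.g ::ₘ o.done) o.rest).map fun t =>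
                  if NondegT t then ((t.consts + t.groups).map (pw ρ)).prod else 0).sum :=
                Multiset.sum_map_le_sum_map _ _ hpt
            _ ≤ W ^ pot obs M (maxArity legs) (o.g ::ₘ o.done) o.rest * ((o.g ::ₘ o.done).map (pw ρ)).prod := IH
            _ = W ^ pot obs M (maxArity legs) (o.g ::ₘ o.done) o.rest * ((o.dp.map ρ).prod * (done.map (pw ρ)).prod) := by
                rw [Multiset.map_cons, Multiset.prod_cons, hpw]
            _ ≤ W ^ (Φ - R0 + rpot obs M (maxArity legs) o.g o.rest o.done)
                  * ((o.dp.map ρ).prod * (done.map (pw ρ)).prod) :=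
                mul_le_mul_of_nonneg_right (pow_le_pow_right₀ hW1 (by rw [hpot]; omega))
                  (mul_nonneg (Multiset.prod_nonneg fun x hx => by
                    obtain ⟨p, -, rfl⟩ := Multiset.mem_map.1 hx; exact hρ p) (prod_pw_nonneg' hρ _))
            _ = _ := by rw [pow_add]; ring
      have hrun : ρ₀ * ((rpot obs M (maxArity legs) (pristine (P := P) obs (rest.min' h)) (rest.erase (rest.min' h)) done
          + N₀ : ℕ) : ℝ) ≤ W := by
        rw [← hR0]
        exact le_trans (mul_le_mul_of_nonneg_left (by exact_mod_cast (by omega : R0 + N₀ ≤ Φ + N₀)) hρ₀0) hW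
      calc _ ≤ ((run Cov trig f c legs obs M (pristine obs (rest.min' h)) (rest.erase (rest.min' h)) done).attach.map
              fun o => W ^ (Φ - R0) * (nds obs M legs ρ W o.1 * (done.map (pw ρ)).prod)).sum :=
            Multiset.sum_map_le_sum_map _ _ fun o _ => hcont o.1 o.2
        _ = W ^ (Φ - R0) * (((run Cov trig f c legs obs M (pristine obs (rest.min' h)) (rest.erase (rest.min' h))
              done).map (nds obs M legs ρ W)).sum * (done.map (pw ρ)).prod) := by
            rw [← Multiset.sum_map_mul_right, ← Multiset.sum_map_mul_left, ← Multiset.attach_map_val'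
              (run Cov trig f c legs obs M (pristine obs (rest.min' h)) (rest.erase (rest.min' h)) done)]
        _ ≤ W ^ (Φ - R0) * (W ^ R0 * (done.map (pw ρ)).prod) := by
            refine mul_le_mul_of_nonneg_left (mul_le_mul_of_nonneg_right ?_ (prod_pw_nonneg' hρ _)) (pow_nonneg hW0 _)
            rw [hR0]
            exact run_lsum_le hobs hlegs hρ hρ₀ hN _ _ _ _ (Nat.lt_succ_self _) hpr hd W hW1 hrun
        _ = W ^ Φ * (done.map (pw ρ)).prod := by rw [← mul_assoc, ← pow_add, Nat.sub_add_cancel hRs]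
    · rw [expand_of_not_nonempty Cov trig f c legs obs M h]
      simp only [Multiset.map_singleton, Multiset.sum_singleton, zero_add]
      split_ifs
      · exact le_mul_of_one_le_left (prod_pw_nonneg' hρ _) (one_le_pow₀ hW1)
      · exact mul_nonneg (pow_nonneg hW0 _) (prod_pw_nonneg' hρ _)

/-- **THE LOCAL COUNT OF THE EXPANSION OF A PRODUCT OF OBSERVABLES** (nothing set aside):
`Σ_{t ∈ expand 0 K, t nondegenerate} Π_{X} pw X ≤ W^{Φ₀(K)}` for `W ≥ max(1, ρ₀·(Φ₀(K) + N₀))`.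
[cite: BalabanImbrieJaffe1988, §5.14 p.311–312] -/
theorem expand_lsum_init_le (hobs : ∀ j, ∀ w ∈ obs j, w ∈ Dir) (hlegs : ∀ m, ∀ w ∈ legs m, w ∈ Dir)
    (hρ : ∀ p, 0 ≤ ρ p) (hρ₀0 : 0 ≤ ρ₀) (hρ₀ : ∀ u ∈ Dir, (∑ p ∈ univ.filter (fun p => Cov p *ᵥ u ≠ 0), ρ p) ≤ ρ₀)
    (hN : ∀ p, ∀ u ∈ Dir,
      (∑ m, ((range (legs m).length).filter fun j => (Cov p *ᵥ u) ⬝ᵥ (legs m).getD j 0 ≠ 0).card) ≤ N₀)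
    (K : Finset κ) {W : ℝ} (hW1 : 1 ≤ W)
    (hW : ρ₀ * ((∑ j ∈ K, ((obs j).length + 1 + M * maxArity legs) + N₀ : ℕ) : ℝ) ≤ W) :
    ((expand Cov trig f c legs obs M 0 K).map fun t =>
        if NondegT t then ((t.consts + t.groups).map (pw ρ)).prod else 0).sum
      ≤ W ^ ∑ j ∈ K, ((obs j).length + 1 + M * maxArity legs) := by
  have h := expand_lsum_le (Cov := Cov) (trig := trig) (f := f) (c := c) (legs := legs) (obs := obs) (M := M)
    hobs hlegs hρ hρ₀0 hρ₀ hN _ 0 K (Nat.lt_succ_self _) (fun h hh => absurd hh (Multiset.notMem_zero _)) W hW1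
  simp only [pot, Multiset.map_zero, Multiset.sum_zero, zero_add, Multiset.prod_zero, mul_one] at h
  exact h hW

end Expand

/-! ## §2  The ℓ¹ norm of the expansion in units of the printed shape -/

section Shape

variable {Cov : P → Matrix S S ℝ} {trig : P → Bool} {f : S → ℝ} {c : ι → ℝ} {legs : ι → List (S → ℝ)}
  {obs : κ → List (S → ℝ)} {M : ℕ} {β : Type} [DecidableEq β] {oc : κ → Finset β} {vc : ι → Finset β}
  {reg : P → Finset β}

/-- **THE SIZES OF ALL THE TERMS, IN UNITS OF THEIR PRINTED SHAPE, SUM TO AT MOST `W^{Φ₀(K)}`**: observables and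
vertex legs with directions in `Dir`; brackets of the piece `p` bounded by `B′_p·ρ_p` with `B′_p ≤ B_ℓ`, no region,
on the local pieces and `B′_p ≤ θ^{#reg p}` on the walk pieces (`B_ℓ ≥ 1`, `0 < θ ≤ 1`), `ρ ≥ 0` with
`Σ_{p : C_p u ≠ 0} ρ p ≤ ρ₀` (`ρ₀ ≥ 0`); couplings `|c m| ≤ cV m`, `cV m·B_ℓ^{|legs m|} ≤ θ^{#vc m}`; at most `N₀`
(vertex, leg) pairs coupled to one `C_p u`; `W ≥ 1`, `ρ₀·(Φ₀(K) + N₀) ≤ W`.  Then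
`Σ_{t ∈ expand 0 K} |coef_t|·Π_{z∈dirs_t}‖z‖ / Π_{X ∈ t.consts + t.groups} shape X ≤ W^{Φ₀(K)}`.
[cite: BalabanImbrieJaffe1988, §5.14 p.312] -/
theorem expand_l1_shape_le {Dir : Set (S → ℝ)} {B' ρ : P → ℝ} {cV : ι → ℝ} {Bl θ ρ₀ W : ℝ} {N₀ : ℕ}
    (hθ0 : 0 < θ) (hθ1 : θ ≤ 1) (hBl : 1 ≤ Bl) (hB0 : ∀ p, 0 ≤ B' p) (hρ : ∀ p, 0 ≤ ρ p) (hcV0 : ∀ m, 0 ≤ cV m)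
    (hB : ∀ p, ∀ u ∈ Dir, ∀ w ∈ Dir, |(Cov p *ᵥ u) ⬝ᵥ w| ≤ B' p * ρ p)
    (hBf : ∀ p, ∀ u ∈ Dir, |(Cov p *ᵥ u) ⬝ᵥ f| ≤ B' p * ρ p) (hBz : ∀ p, ∀ u ∈ Dir, ‖Cov p *ᵥ u‖ ≤ B' p * ρ p)
    (hcV : ∀ m, |c m| ≤ cV m) (hobs : ∀ j, ∀ w ∈ obs j, w ∈ Dir) (hlegs : ∀ m, ∀ w ∈ legs m, w ∈ Dir)
    (hloc : ∀ p, trig p = false → B' p ≤ Bl ∧ reg p = ∅) (hwalk : ∀ p, trig p = true → B' p ≤ θ ^ (reg p).card)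
    (hvert : ∀ m, cV m * Bl ^ (legs m).length ≤ θ ^ (vc m).card) (hρ₀0 : 0 ≤ ρ₀)
    (hρ₀ : ∀ u ∈ Dir, (∑ p ∈ univ.filter (fun p => Cov p *ᵥ u ≠ 0), ρ p) ≤ ρ₀)
    (hN : ∀ p, ∀ u ∈ Dir,
      (∑ m, ((range (legs m).length).filter fun j => (Cov p *ᵥ u) ⬝ᵥ (legs m).getD j 0 ≠ 0).card) ≤ N₀)
    (K : Finset κ) (hW1 : 1 ≤ W)
    (hW : ρ₀ * ((∑ j ∈ K, ((obs j).length + 1 + M * maxArity legs) + N₀ : ℕ) : ℝ) ≤ W) :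
    ((expand Cov trig f c legs obs M 0 K).map fun t =>
        |t.coef| * (t.dirs.map fun z => ‖z‖).prod
          / ((t.consts + t.groups).map (shape obs oc vc reg Bl θ)).prod).sum
      ≤ W ^ ∑ j ∈ K, ((obs j).length + 1 + M * maxArity legs) := by
  have hBρ0 : ∀ p, 0 ≤ B' p * ρ p := fun p => mul_nonneg (hB0 p) (hρ p)
  have hshape0 : ∀ g : WGrp S κ ι P, 0 < shape obs oc vc reg Bl θ g := fun g =>
    mul_pos (prod_pos fun j _ => pow_pos (zero_lt_one.trans_le hBl) _) (pow_pos hθ0 _)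
  have hwt0 : ∀ g : WGrp S κ ι P, 0 ≤ wt B' cV g := fun g =>
    mul_nonneg (Multiset.prod_nonneg fun x hx => by obtain ⟨p, -, rfl⟩ := Multiset.mem_map.1 hx; exact hB0 p)
      (Multiset.prod_nonneg fun x hx => by obtain ⟨m, -, rfl⟩ := Multiset.mem_map.1 hx; exact hcV0 m)
  have hsplit : ∀ g : WGrp S κ ι P, wt (fun p => B' p * ρ p) cV g = wt B' cV g * pw ρ g := fun g => by
    simp only [wt, pw, Multiset.prod_map_mul]; ring
  -- pointwise: the size of a term in units of its shape is at most its counting weight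
  have hpt : ∀ t ∈ expand Cov trig f c legs obs M 0 K,
      |t.coef| * (t.dirs.map fun z => ‖z‖).prod / ((t.consts + t.groups).map (shape obs oc vc reg Bl θ)).prod
        ≤ (if NondegT t then ((t.consts + t.groups).map (pw ρ)).prod else 0) := by
    intro t ht
    have hS : 0 < ((t.consts + t.groups).map (shape obs oc vc reg Bl θ)).prod :=
      Multiset.prod_pos fun x hx => by obtain ⟨g, -, rfl⟩ := Multiset.mem_map.1 hx; exact hshape0 g
    rw [div_le_iff₀ hS]
    by_cases hT : NondegT t
    · rw [if_pos hT]
      obtain ⟨hTc, hTg⟩ := expand_tidy (Cov := Cov) (trig := trig) (f := f) (c := c) (M := M) _ 0 K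
        (Nat.lt_succ_self _) (envOK_zero K) t ht
      have hTidy : ∀ g ∈ t.consts + t.groups, Tidy obs legs g := fun g hg => by
        rcases Multiset.mem_add.1 hg with hg | hg
        · exact hTc g hg
        · exact hTg g hg
      have hw := expand_weight_init (trig := trig) (M := M) (B := fun p => B' p * ρ p) hBρ0 hcV0 hB hBf hBz hcV
        hobs hlegs K t ht
      rw [← Multiset.prod_add, ← Multiset.map_add] at hw
      have e : ((t.consts + t.groups).map (wt (fun p => B' p * ρ p) cV)).prod
          = ((t.consts + t.groups).map (wt B' cV)).prod * ((t.consts + t.groups).map (pw ρ)).prod := by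
        rw [← Multiset.prod_map_mul]
        exact congrArg _ (Multiset.map_congr rfl fun g _ => hsplit g)
      have hle : ((t.consts + t.groups).map (wt B' cV)).prod
          ≤ ((t.consts + t.groups).map (shape obs oc vc reg Bl θ)).prod :=
        Multiset.prod_map_le_prod_map₀ _ _ (fun g _ => hwt0 g) fun g hg =>
          wt_le_shape hθ0 hθ1 hBl hB0 hcV0 hloc hwalk hvert g (hTidy g hg)
      calc |t.coef| * (t.dirs.map fun z => ‖z‖).prod
          ≤ ((t.consts + t.groups).map (wt B' cV)).prod * ((t.consts + t.groups).map (pw ρ)).prod := hw.trans_eq e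
        _ ≤ ((t.consts + t.groups).map (shape obs oc vc reg Bl θ)).prod * ((t.consts + t.groups).map (pw ρ)).prod :=
            mul_le_mul_of_nonneg_right hle (prod_pw_nonneg' hρ _)
        _ = _ := mul_comm _ _
    · -- a degenerate term has size zero
      rw [if_neg hT, zero_mul]
      refine le_of_eq ?_
      simp only [NondegT, not_and_or, not_forall, not_not, exists_prop] at hT
      rcases hT with hc | ⟨z, hz, rfl⟩
      · rw [hc, abs_zero, zero_mul]
      · rw [List.prod_eq_zero (List.mem_map.2 ⟨0, hz, norm_zero⟩), mul_zero]
  exact (Multiset.sum_map_le_sum_map _ _ hpt).trans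
    (expand_lsum_init_le (trig := trig) (f := f) (c := c) hobs hlegs hρ hρ₀0 hρ₀ hN K hW1 hW)

end Shape

end Literature.MathematicalPhysics.QuantumFieldTheory.BalabanImbrieJaffe1984to88.BIJ88WalkLocalTermCount312

end
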